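import Summits.Ventures.HodgeRepro2.T5SU11KFiniteMajorantPow
import Summits.Ventures.HodgeRepro2.T5SU11CfunPole
import Summits.Ventures.HodgeRepro2.T5SU11XiTransform

/-!
# The shape of the Jacobi transform on its strip: monotone away from `λ = 1` in `|λ − 1|`, and
blowing up at both edges

The transform `λ ↦ m̂_k(λ) = ∫_G (1 − |g·0|²)^{k/2} φ_λ dν` on the strip `2 − k < λ < k` is log-convex
(`T5SU11XiTransform.convexOn_log_jacobi`), symmetric under `λ ↦ 2 − λ`
(`T5SU11JacobiTransform.integral_orbit_rpow_mul_sph_two_sub'`), strictly positive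
(`T5SU11KFiniteMajorantPow.jacobi_pos`) and minimal at `λ = 1`
(`T5SU11XiTransform.xi_transform_le_jacobi`). Hence it is **monotone on `[1, k)`**
(`monotoneOn_jacobi`), **antitone on `(2 − k, 1]`** (`antitoneOn_jacobi`) — altogether an increasing
function of `|λ − 1|` (`jacobi_le_jacobi_of_abs_sub_one_le`), so that on every closed sub-strip
`|λ − 1| ≤ r < k − 1` it lies between `C_k²` and `m̂_k(1 + r)` — and, by the simple poles of
`T5SU11CfunPole`, it **tends to `+∞` at both edges** of the strip (`tendsto_jacobi_nhdsLT_atTop`,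
`tendsto_jacobi_nhdsGT_atTop`). Nothing is claimed about (N).

Blind lane: Mathlib + the HodgeRepro2 prefix only; no sorry; axioms ⊆ {propext, Classical.choice,
Quot.sound}.
-/

namespace Summit.Ventures.HodgeRepro2.T5SU11JacobiMonotone

open MeasureTheory MeasureTheory.Measure Metric Set Filter Topology
open T5SU11Unimodular T5SU11Fibration T5SU11Cartan T5HaarCircle T5BergmanCoefficient
  T5SU11FibrationHaar T5SU11SphericalFunction T5SU11JacobiIwasawa T5SU11JacobiTransform
  T5SU11XiTransform T5SU11CfunPole T5SU11KFiniteMajorantPow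
open scoped Real

/-! ### Auxiliary limits -/

/-- `2^{k−1} C_k > 0`. -/
lemma pole_residue_pos {k : ℝ} (hk : 1 < k) :
    0 < 2 ^ (k - 1) * (√π * Real.Gamma ((k - 1) / 2) / Real.Gamma (k / 2)) := by
  have h1 := Real.Gamma_pos_of_pos (show 0 < (k - 1) / 2 by linarith)
  have h2 := Real.Gamma_pos_of_pos (show 0 < k / 2 by linarith)
  have h3 := Real.sqrt_pos.mpr Real.pi_pos
  have h4 : (0 : ℝ) < 2 ^ (k - 1) := Real.rpow_pos_of_pos (by norm_num) _
  positivity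

/-- `(k − λ)⁻¹ → +∞` as `λ → k⁻`. -/
lemma tendsto_inv_sub_nhdsLT_atTop (k : ℝ) :
    Tendsto (fun lam : ℝ => (k - lam)⁻¹) (𝓝[<] k) atTop := by
  have h0 : Tendsto (fun lam : ℝ => k - lam) (𝓝[<] k) (𝓝[>] 0) := by
    refine tendsto_nhdsWithin_iff.mpr ⟨?_, ?_⟩
    · have : Tendsto (fun lam : ℝ => k - lam) (𝓝 k) (𝓝 (k - k)) :=
        tendsto_const_nhds.sub tendsto_id
      rw [sub_self] at this
      exact this.mono_left nhdsWithin_le_nhds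
    · filter_upwards [self_mem_nhdsWithin] with lam hlam
      exact sub_pos.mpr (Set.mem_Iio.mp hlam)
  exact Filter.Tendsto.inv_tendsto_nhdsGT_zero h0

/-- `λ ↦ 2 − λ` maps `𝓝[>] (2 − k)` into `𝓝[<] k`. -/
lemma tendsto_two_sub_nhdsGT (k : ℝ) :
    Tendsto (fun lam : ℝ => 2 - lam) (𝓝[>] (2 - k)) (𝓝[<] k) := by
  refine tendsto_nhdsWithin_iff.mpr ⟨?_, ?_⟩
  · have : Tendsto (fun lam : ℝ => 2 - lam) (𝓝 (2 - k)) (𝓝 (2 - (2 - k))) :=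
      tendsto_const_nhds.sub tendsto_id
    rw [sub_sub_cancel] at this
    exact this.mono_left nhdsWithin_le_nhds
  · filter_upwards [self_mem_nhdsWithin] with lam hlam
    exact sub_lt_comm.mp (Set.mem_Ioi.mp hlam)

section measure

variable [MeasurableSpace Circle] [BorelSpace Circle]

/-! ### Monotonicity -/

/-- `log m̂_k(1) ≤ log m̂_k(λ)` on the strip. -/
lemma log_jacobi_one_le {k lam : ℝ} (hk : 1 < k) (h1 : lam < k) (h2 : 2 < k + lam) :
    Real.log (∫ g, (1 - ‖orbit g‖ ^ 2) ^ (k / 2) * sph 1 g ∂(nu haarCircle))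
      ≤ Real.log (∫ g, (1 - ‖orbit g‖ ^ 2) ^ (k / 2) * sph lam g ∂(nu haarCircle)) :=
  Real.log_le_log (jacobi_pos hk hk (by linarith)) (xi_transform_le_jacobi hk h1 h2)

/-- **Monotone on the right half of the strip**: `1 ≤ λ₁ ≤ λ₂ < k ⇒ m̂_k(λ₁) ≤ m̂_k(λ₂)` (log-convexity
with the minimum at `λ = 1`). -/
theorem jacobi_le_jacobi_of_one_le {k l1 l2 : ℝ} (hk : 1 < k) (h1 : 1 ≤ l1) (h12 : l1 ≤ l2)
    (h2 : l2 < k) :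
    ∫ g, (1 - ‖orbit g‖ ^ 2) ^ (k / 2) * sph l1 g ∂(nu haarCircle)
      ≤ ∫ g, (1 - ‖orbit g‖ ^ 2) ^ (k / 2) * sph l2 g ∂(nu haarCircle) := by
  rcases h1.eq_or_lt with rfl | h1'
  · exact xi_transform_le_jacobi hk h2 (by linarith)
  · have hx : (1 : ℝ) ∈ Ioo (2 - k) k := ⟨by linarith, hk⟩
    have hz : l2 ∈ Ioo (2 - k) k := ⟨by linarith, h2⟩
    have hlog := (convexOn_log_jacobi hk).le_right_of_left_le'' hx hz h1' h12
      (log_jacobi_one_le hk (by linarith) (by linarith))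
    exact (Real.log_le_log_iff (jacobi_pos hk (by linarith) (by linarith))
      (jacobi_pos hk h2 (by linarith))).mp hlog

/-- **`λ ↦ m̂_k(λ)` is monotone on `[1, k)`**. -/
theorem monotoneOn_jacobi {k : ℝ} (hk : 1 < k) :
    MonotoneOn (fun lam => ∫ g, (1 - ‖orbit g‖ ^ 2) ^ (k / 2) * sph lam g ∂(nu haarCircle))
      (Ico 1 k) :=
  fun _ hl1 _ hl2 h12 => jacobi_le_jacobi_of_one_le hk hl1.1 h12 hl2.2

/-- **Antitone on the left half of the strip**: `2 − k < λ₁ ≤ λ₂ ≤ 1 ⇒ m̂_k(λ₂) ≤ m̂_k(λ₁)` (by the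
symmetry `λ ↦ 2 − λ`). -/
theorem jacobi_le_jacobi_of_le_one {k l1 l2 : ℝ} (hk : 1 < k) (h1 : 2 - k < l1) (h12 : l1 ≤ l2)
    (h2 : l2 ≤ 1) :
    ∫ g, (1 - ‖orbit g‖ ^ 2) ^ (k / 2) * sph l2 g ∂(nu haarCircle)
      ≤ ∫ g, (1 - ‖orbit g‖ ^ 2) ^ (k / 2) * sph l1 g ∂(nu haarCircle) := by
  rw [← integral_orbit_rpow_mul_sph_two_sub' k l1, ← integral_orbit_rpow_mul_sph_two_sub' k l2]
  exact jacobi_le_jacobi_of_one_le hk (by linarith) (by linarith) (by linarith)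

/-- **`λ ↦ m̂_k(λ)` is antitone on `(2 − k, 1]`**. -/
theorem antitoneOn_jacobi {k : ℝ} (hk : 1 < k) :
    AntitoneOn (fun lam => ∫ g, (1 - ‖orbit g‖ ^ 2) ^ (k / 2) * sph lam g ∂(nu haarCircle))
      (Ioc (2 - k) 1) :=
  fun _ hl1 _ hl2 h12 => jacobi_le_jacobi_of_le_one hk hl1.1 h12 hl2.2

/-- The transform is a function of `|λ − 1|`: `m̂_k(λ) = m̂_k(1 + |λ − 1|)`. -/
lemma jacobi_eq_jacobi_one_add_abs (k lam : ℝ) :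
    ∫ g, (1 - ‖orbit g‖ ^ 2) ^ (k / 2) * sph lam g ∂(nu haarCircle)
      = ∫ g, (1 - ‖orbit g‖ ^ 2) ^ (k / 2) * sph (1 + |lam - 1|) g ∂(nu haarCircle) := by
  rcases le_or_gt 1 lam with h | h
  · rw [abs_of_nonneg (by linarith), show (1 : ℝ) + (lam - 1) = lam by ring]
  · rw [abs_of_neg (by linarith), ← integral_orbit_rpow_mul_sph_two_sub' k lam,
      show (1 : ℝ) + -(lam - 1) = 2 - lam by ring]

/-- **The transform increases with `|λ − 1|`**: `|λ₁ − 1| ≤ |λ₂ − 1| < k − 1 ⇒ m̂_k(λ₁) ≤ m̂_k(λ₂)`. In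
particular on every closed sub-strip `|λ − 1| ≤ r < k − 1`, `C_k² ≤ m̂_k(λ) ≤ m̂_k(1 + r)`. -/
theorem jacobi_le_jacobi_of_abs_sub_one_le {k l1 l2 : ℝ} (hk : 1 < k) (h12 : |l1 - 1| ≤ |l2 - 1|)
    (h2 : |l2 - 1| < k - 1) :
    ∫ g, (1 - ‖orbit g‖ ^ 2) ^ (k / 2) * sph l1 g ∂(nu haarCircle)
      ≤ ∫ g, (1 - ‖orbit g‖ ^ 2) ^ (k / 2) * sph l2 g ∂(nu haarCircle) := by
  rw [jacobi_eq_jacobi_one_add_abs k l1, jacobi_eq_jacobi_one_add_abs k l2]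
  exact jacobi_le_jacobi_of_one_le hk (by linarith [abs_nonneg (l1 - 1)]) (by linarith) (by linarith)

/-- **Uniform bound on a closed sub-strip**: `|λ − 1| ≤ r < k − 1 ⇒ m̂_k(λ) ≤ m̂_k(1 + r)`. -/
theorem jacobi_le_of_abs_sub_one_le {k r lam : ℝ} (hk : 1 < k) (hr : r < k - 1) (h : |lam - 1| ≤ r) :
    ∫ g, (1 - ‖orbit g‖ ^ 2) ^ (k / 2) * sph lam g ∂(nu haarCircle)
      ≤ ∫ g, (1 - ‖orbit g‖ ^ 2) ^ (k / 2) * sph (1 + r) g ∂(nu haarCircle) := by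
  have hr0 : 0 ≤ r := (abs_nonneg _).trans h
  refine jacobi_le_jacobi_of_abs_sub_one_le hk ?_ ?_
  · rw [show (1 : ℝ) + r - 1 = r by ring, abs_of_nonneg hr0]; exact h
  · rw [show (1 : ℝ) + r - 1 = r by ring, abs_of_nonneg hr0]; exact hr

/-! ### Blow-up at the edges of the strip -/

/-- **Blow-up at the right edge**: `m̂_k(λ) → +∞` as `λ → k⁻` (the simple pole of
`T5SU11CfunPole.tendsto_sub_mul_jacobi_nhdsLT` with positive residue). -/
theorem tendsto_jacobi_nhdsLT_atTop {k : ℝ} (hk : 1 < k) :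
    Tendsto (fun lam => ∫ g, (1 - ‖orbit g‖ ^ 2) ^ (k / 2) * sph lam g ∂(nu haarCircle)) (𝓝[<] k)
      atTop := by
  have h := (tendsto_inv_sub_nhdsLT_atTop k).atTop_mul_pos (pole_residue_pos hk)
    (tendsto_sub_mul_jacobi_nhdsLT hk)
  refine h.congr' ?_
  filter_upwards [self_mem_nhdsWithin] with lam hlam
  have hne : k - lam ≠ 0 := sub_ne_zero.mpr (ne_of_gt hlam)
  exact inv_mul_cancel_left₀ hne _

/-- **Blow-up at the left edge**: `m̂_k(λ) → +∞` as `λ → (2 − k)⁺` (by the symmetry `λ ↦ 2 − λ`). -/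
theorem tendsto_jacobi_nhdsGT_atTop {k : ℝ} (hk : 1 < k) :
    Tendsto (fun lam => ∫ g, (1 - ‖orbit g‖ ^ 2) ^ (k / 2) * sph lam g ∂(nu haarCircle))
      (𝓝[>] (2 - k)) atTop := by
  have h := (tendsto_jacobi_nhdsLT_atTop hk).comp (tendsto_two_sub_nhdsGT k)
  refine h.congr fun lam => ?_
  exact integral_orbit_rpow_mul_sph_two_sub' k lam

end measure

end Summit.Ventures.HodgeRepro2.T5SU11JacobiMonotone
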